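import Literature.Geometry.ComplexAnalytic.ParametricMorseOneVariable
import Literature.Geometry.ComplexAnalytic.HolomorphicMorseLemma
import Mathlib.LinearAlgebra.Matrix.Notation
import HarnessLib

/-!
# The EQUIVARIANT `A₃` normal form `Z₀² + Z₁² + Z₂⁴` of `F(y,m,s) = A(m,s⁴)·y² − G(m,s⁴)`

Layer `Literature/Geometry/ComplexAnalytic`; theorems only (no definition, no named fact). Written by the prover seat
`hodge-nonav-prover-Bx` (g21, cell `hodge-nonav`) as brick N4-b of the programme «BRANCH CHART» (memo
`HOME/memos/S5-GLOBAL-ARCHITECTURE-Bx-g21.md` §2) = brick L6-2 of crux K1Q `VeryGeneralQuaternionCommutatorsInHg`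
(`Summits/HodgeConjecture/HodgeConjecture/Theses/Q8SymplecticPowers.lean`, stmt-HodgeConjecture-24190, stub S9, S5-half).

SETTING. On the μ₄×μ₂ branch chart of the quaternionic quartic family the pencil coordinate near a d6 (simple tangency)
point reads, in the global coordinates `(y, m, s)` of the chart, `F(y,m,s) = A(m,s⁴)·y² − G(m,s⁴)` with `A, G` analytic at
`(m₀, 0)`, `A(m₀,0) ≠ 0`, `∂_m G(m₀,0) = 0`, `∂²_m G(m₀,0) ≠ 0`, `∂_σ G(m₀,0) ≠ 0`; the covering involution is
`ι : (y,m,s) ↦ (−y,m,−s)` and the deck generator is `τ̃ : (y,m,s) ↦ (y,m,i·s)`.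

THEOREM (`exists_equivariantA3Chart`). There is a holomorphic chart `Θ` of `ℂ³` (coordinates `Fin 3 → ℂ`, `0 ↔ y`, `1 ↔ m`,
`2 ↔ s`) at `z₀ = (0, m₀, 0)` with `Θ z₀ = 0`, real `C^∞` with `C^∞` inverse, such that on its source (a polydisc centred at `z₀`)

  `(Θ z)₀² + (Θ z)₁² + (Θ z)₂⁴ = F z − F z₀`   (the `A₃` normal form, exponents `(2,2,4)` = the tree's `cyclicNodeExponents 4`),

and `Θ` COMMUTES ON THE NOSE with every diagonal map `(y,m,s) ↦ (ε₀ y, m, ε₂ s)`, `‖ε₀‖ = 1`, `ε₂⁴ = 1` — in particular with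
`ι = diag(−1,1,−1)` (Ax's `PhamBrieskornA3Involution.iotaFibre`) and `τ̃ = diag(1,1,i)` (the model deck `z₂ ↦ ζ₄ z₂`).
Construction: `Z₀ = y·√A(m,s⁴)`, `Z₁ = i·(m − φ(s⁴))·√e(m,s⁴)` (critical curve `φ` and `e` of
`ParametricMorseOneVariable.exists_eq_criticalValue_add_sq`), `Z₂ = s·(−g₁(s⁴))^{1/4}` where `G(φ σ, σ) − G(m₀,0) = σ·g₁(σ)`,
`g₁(0) = ∂_σ G(m₀,0) ≠ 0`; every unit is a function of `(m, s⁴)`, whence the equivariance; the Jacobian at `z₀` is diagonal with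
non-zero entries, and the tree's `HolomorphicMorse.exists_openPartialHomeomorph_contDiffOn_symm` packages the chart.

Honest scope: a local holomorphic coordinate change; nothing here bears on HC.

## References

* [ArnoldGuseinZadeVarchenko1985] AGZV I, §9.6 (Morse lemma with parameters), §11.1 (`A_k : x^{k+1} + Σ yᵢ²`).
* [ArnoldGuseinzadeVarchenko2012] AGZV II, Part I §2.3 (quasi-homogeneous normal forms) and §5.2 (symmetric singularities).
* [Milnor1968] J. Milnor, *Singular Points of Complex Hypersurfaces*, §9 (Brieskorn–Pham polynomials).
-/

noncomputable section

open Filter Set Metric Complex Topology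
open scoped ContDiff

namespace Literature.Geometry.ComplexAnalytic.EquivariantA3

open Literature.Geometry.ComplexAnalytic.ParametricMorse
open Literature.Geometry.ComplexAnalytic.HolomorphicMorse

/-- The diagonal matrix `(ε₀, 1, ε₂)` with `‖ε₀‖ = 1`, `ε₂⁴ = 1` does not increase the distance to `z₀ = (0, m₀, 0)`. [folklore] -/
private theorem dist_diag_le (m₀ ε₀ ε₂ : ℂ) (h₀ : ‖ε₀‖ = 1) (h₂ : ε₂ ^ 4 = 1) (z : Fin 3 → ℂ) :
    dist (fun i => (![ε₀, 1, ε₂] : Fin 3 → ℂ) i * z i) (Pi.single 1 m₀) ≤ dist z (Pi.single 1 m₀) := by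
  have h₂' : ‖ε₂‖ = 1 := by
    have h := congrArg norm h₂
    rw [norm_pow, norm_one] at h
    exact (pow_eq_one_iff_of_nonneg (norm_nonneg _) (by norm_num)).1 h
  refine (dist_pi_le_iff dist_nonneg).2 fun i => ?_
  have hi := dist_le_pi_dist z (Pi.single (1 : Fin 3) m₀) i
  fin_cases i
  · simpa [dist_eq_norm, h₀] using hi
  · simpa using hi
  · simpa [dist_eq_norm, h₂', norm_mul] using hi

/-- **The equivariant `A₃` normal form** (module docstring). [cite: ArnoldGuseinZadeVarchenko1985, §9.6 and §11.1]
[cite: ArnoldGuseinzadeVarchenko2012, Part I §2.3] [cite: Milnor1968, §9] -/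
theorem exists_equivariantA3Chart {A G : ℂ × ℂ → ℂ} {m₀ : ℂ}
    (hA : AnalyticAt ℂ A (m₀, 0)) (hA0 : A (m₀, 0) ≠ 0) (hG : AnalyticAt ℂ G (m₀, 0))
    (h1 : deriv (fun m => G (m, 0)) m₀ = 0) (h2 : iteratedDeriv 2 (fun m => G (m, 0)) m₀ ≠ 0)
    (h3 : deriv (fun σ => G (m₀, σ)) 0 ≠ 0) :
    ∃ Θ : OpenPartialHomeomorph (Fin 3 → ℂ) (Fin 3 → ℂ),
      (Pi.single 1 m₀ : Fin 3 → ℂ) ∈ Θ.source ∧ Θ (Pi.single 1 m₀) = 0 ∧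
      DifferentiableOn ℂ Θ Θ.source ∧ ContDiffOn ℝ ∞ Θ Θ.source ∧ ContDiffOn ℝ ∞ Θ.symm Θ.target ∧
      (∀ z ∈ Θ.source, Θ z 0 ^ 2 + Θ z 1 ^ 2 + Θ z 2 ^ 4 =
        A (z 1, z 2 ^ 4) * z 0 ^ 2 - G (z 1, z 2 ^ 4) + G (m₀, 0)) ∧
      (∀ ε₀ ε₂ : ℂ, ‖ε₀‖ = 1 → ε₂ ^ 4 = 1 → ∀ z ∈ Θ.source,
        (fun i => (![ε₀, 1, ε₂] : Fin 3 → ℂ) i * z i) ∈ Θ.source ∧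
        Θ (fun i => (![ε₀, 1, ε₂] : Fin 3 → ℂ) i * z i) = fun i => (![ε₀, 1, ε₂] : Fin 3 → ℂ) i * Θ z i) := by
  classical
  -- (1) square completion of `G` along its critical curve
  obtain ⟨φ, r, hφ, hφ0, hr, hr0, hev⟩ := exists_eq_criticalValue_add_sq (p := (m₀, 0)) hG h1 h2
  simp only at hφ hφ0 hev
  -- (2) the critical-value function `g₀ σ = G (φ σ, σ) − G (m₀, 0)` has a simple zero at `0`
  set g₀ : ℂ → ℂ := fun σ => G (φ σ, σ) - G (m₀, 0) with hg₀def
  have hcurve_an : AnalyticAt ℂ (fun σ => ((φ σ, σ) : ℂ × ℂ)) 0 := hφ.prod analyticAt_id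
  have hg₀an : AnalyticAt ℂ g₀ 0 := (hG.comp_of_eq hcurve_an (by simp [hφ0])).sub analyticAt_const
  have hg₀0 : g₀ 0 = 0 := by simp [hg₀def, hφ0]
  have hg₀' : deriv g₀ 0 = deriv (fun σ => G (m₀, σ)) 0 := by
    have hc : HasDerivAt (fun σ => ((φ σ, σ) : ℂ × ℂ)) (deriv φ 0, 1) 0 :=
      hφ.differentiableAt.hasDerivAt.prodMk (hasDerivAt_id 0)
    have hGd : HasFDerivAt G (fderiv ℂ G (m₀, 0)) (φ 0, 0) := by
      rw [hφ0]; exact hG.differentiableAt.hasFDerivAt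
    have hd : HasDerivAt (fun σ => G (φ σ, σ)) (fderiv ℂ G (m₀, 0) (deriv φ 0, 1)) 0 :=
      hGd.comp_hasDerivAt_of_eq 0 hc rfl
    have hsplit : ((deriv φ 0, (1 : ℂ)) : ℂ × ℂ) = deriv φ 0 • ((1 : ℂ), (0 : ℂ)) + ((0 : ℂ), (1 : ℂ)) := by simp
    have h10 : fderiv ℂ G (m₀, 0) (1, 0) = 0 := by
      rw [← (hasDerivAt_fst_slice (z := (m₀, 0)) hG.differentiableAt).deriv]; exact h1
    have h01 : fderiv ℂ G (m₀, 0) (0, 1) = deriv (fun σ => G (m₀, σ)) 0 :=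
      ((hasDerivAt_snd_slice (z := (m₀, 0)) hG.differentiableAt).deriv).symm
    rw [show g₀ = fun σ => G (φ σ, σ) - G (m₀, 0) from rfl, (hd.sub_const _).deriv, hsplit, map_add, map_smul,
      h10, smul_zero, zero_add, h01]
  obtain ⟨pw, hpw⟩ := hg₀an
  set g₁ : ℂ → ℂ := dslope g₀ 0 with hg₁def
  have hg₁an : AnalyticAt ℂ g₁ 0 := ⟨_, hpw.has_fpower_series_dslope_fslope⟩
  have hg₁0 : g₁ 0 ≠ 0 := by rw [hg₁def, dslope_same, hg₀']; exact h3
  have hg₀eq : ∀ σ, g₀ σ = σ * g₁ σ := fun σ => by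
    have h := sub_smul_dslope g₀ 0 σ
    rw [sub_zero, smul_eq_mul, hg₀0, sub_zero] at h
    exact h.symm
  -- (3) roots of units: `ρ⁴ = −g₁` near `0`, `q² = A` near `(m₀, 0)`
  obtain ⟨ρ, hρ, hρ0, hρev0⟩ := exists_pow_eq_of_ne_zero hg₁an.neg (neg_ne_zero.2 hg₁0) (k := 4) (by norm_num)
  have hρev : ∀ᶠ y in 𝓝 (0 : ℂ), AnalyticAt ℂ ρ y ∧ ρ y ^ 4 = -g₁ y :=
    hρev0.mono fun y hy => ⟨hy.1, by simpa only [Pi.neg_apply] using hy.2⟩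
  obtain ⟨q, hq, hq0, hqev⟩ := exists_pow_eq_of_ne_zero hA hA0 (k := 2) two_ne_zero
  -- (4) the coordinate functions
  set z₀ : Fin 3 → ℂ := Pi.single 1 m₀ with hz₀def
  have hz₀0 : z₀ 0 = 0 := by simp [hz₀def]
  have hz₀1 : z₀ 1 = m₀ := by simp [hz₀def]
  have hz₀2 : z₀ 2 = 0 := by simp [hz₀def]
  set w : (Fin 3 → ℂ) → ℂ × ℂ := fun z => (z 1, z 2 ^ 4) with hwdef
  have hw0 : w z₀ = (m₀, 0) := by simp [hwdef, hz₀1, hz₀2]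
  have hw_an : ∀ z, AnalyticAt ℂ w z := fun z =>
    ((ContinuousLinearMap.proj (R := ℂ) (φ := fun _ : Fin 3 => ℂ) 1).analyticAt z).prod
      (((ContinuousLinearMap.proj (R := ℂ) (φ := fun _ : Fin 3 => ℂ) 2).analyticAt z).pow 4)
  have hs4_an : ∀ z : Fin 3 → ℂ, AnalyticAt ℂ (fun z : Fin 3 → ℂ => z 2 ^ 4) z := fun z =>
    ((ContinuousLinearMap.proj (R := ℂ) (φ := fun _ : Fin 3 => ℂ) 2).analyticAt z).pow 4
  set Θf : (Fin 3 → ℂ) → (Fin 3 → ℂ) := fun z =>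
    ![z 0 * q (w z), I * ((z 1 - φ (z 2 ^ 4)) * r (w z)), z 2 * ρ (z 2 ^ 4)] with hΘfdef
  have hΘf0 : ∀ z, Θf z 0 = z 0 * q (w z) := fun z => by simp [hΘfdef]
  have hΘf1 : ∀ z, Θf z 1 = I * ((z 1 - φ (z 2 ^ 4)) * r (w z)) := fun z => by simp [hΘfdef]
  have hΘf2 : ∀ z, Θf z 2 = z 2 * ρ (z 2 ^ 4) := fun z => by simp [hΘfdef]
  -- (5) everything holds on a neighbourhood of `z₀`
  have hwt : Tendsto w (𝓝 z₀) (𝓝 (m₀, 0)) := by rw [← hw0]; exact (hw_an z₀).continuousAt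
  have hst : Tendsto (fun z : Fin 3 → ℂ => z 2 ^ 4) (𝓝 z₀) (𝓝 0) := by
    have h := (hs4_an z₀).continuousAt.tendsto
    simpa [hz₀2] using h
  have hgood : ∀ᶠ z in 𝓝 z₀, (AnalyticAt ℂ q (w z) ∧ q (w z) ^ 2 = A (w z)) ∧
      (AnalyticAt ℂ G (w z) ∧ AnalyticAt ℂ G (φ (w z).2, (w z).2) ∧ AnalyticAt ℂ φ (w z).2 ∧ AnalyticAt ℂ r (w z) ∧
        deriv (fun m => G (m, (w z).2)) (φ (w z).2) = 0 ∧ G (w z) = G (φ (w z).2, (w z).2) + (((w z).1 - φ (w z).2) * r (w z)) ^ 2) ∧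
      (AnalyticAt ℂ ρ (z 2 ^ 4) ∧ ρ (z 2 ^ 4) ^ 4 = -g₁ (z 2 ^ 4)) :=
    (hwt.eventually hqev).and ((hwt.eventually hev).and (hst.eventually hρev))
  have han_of_good : ∀ z, ((AnalyticAt ℂ q (w z) ∧ q (w z) ^ 2 = A (w z)) ∧
      (AnalyticAt ℂ G (w z) ∧ AnalyticAt ℂ G (φ (w z).2, (w z).2) ∧ AnalyticAt ℂ φ (w z).2 ∧ AnalyticAt ℂ r (w z) ∧
        deriv (fun m => G (m, (w z).2)) (φ (w z).2) = 0 ∧ G (w z) = G (φ (w z).2, (w z).2) + (((w z).1 - φ (w z).2) * r (w z)) ^ 2) ∧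
      (AnalyticAt ℂ ρ (z 2 ^ 4) ∧ ρ (z 2 ^ 4) ^ 4 = -g₁ (z 2 ^ 4))) → AnalyticAt ℂ Θf z := by
    rintro z ⟨⟨hqz, -⟩, ⟨-, -, hφz, hrz, -, -⟩, hρz, -⟩
    have hp0 : AnalyticAt ℂ (fun z : Fin 3 → ℂ => z 0) z := (ContinuousLinearMap.proj (R := ℂ) (φ := fun _ : Fin 3 => ℂ) 0).analyticAt z
    have hp1 : AnalyticAt ℂ (fun z : Fin 3 → ℂ => z 1) z := (ContinuousLinearMap.proj (R := ℂ) (φ := fun _ : Fin 3 => ℂ) 1).analyticAt z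
    have hp2 : AnalyticAt ℂ (fun z : Fin 3 → ℂ => z 2) z := (ContinuousLinearMap.proj (R := ℂ) (φ := fun _ : Fin 3 => ℂ) 2).analyticAt z
    have c0 : AnalyticAt ℂ (fun z => z 0 * q (w z)) z := hp0.mul (hqz.comp (hw_an z))
    have c1 : AnalyticAt ℂ (fun z => I * ((z 1 - φ (z 2 ^ 4)) * r (w z))) z :=
      analyticAt_const.mul ((hp1.sub (hφz.comp_of_eq (hs4_an z) (by simp [hwdef]))).mul (hrz.comp (hw_an z)))
    have c2 : AnalyticAt ℂ (fun z => z 2 * ρ (z 2 ^ 4)) z := hp2.mul (hρz.comp_of_eq (hs4_an z) rfl)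
    refine (contDiffAt_pi' (n := ω) fun i => ?_).analyticAt
    fin_cases i
    · simpa [hΘfdef] using c0.contDiffAt
    · simpa [hΘfdef] using c1.contDiffAt
    · simpa [hΘfdef] using c2.contDiffAt
  have hNF_of_good : ∀ z, ((AnalyticAt ℂ q (w z) ∧ q (w z) ^ 2 = A (w z)) ∧
      (AnalyticAt ℂ G (w z) ∧ AnalyticAt ℂ G (φ (w z).2, (w z).2) ∧ AnalyticAt ℂ φ (w z).2 ∧ AnalyticAt ℂ r (w z) ∧
        deriv (fun m => G (m, (w z).2)) (φ (w z).2) = 0 ∧ G (w z) = G (φ (w z).2, (w z).2) + (((w z).1 - φ (w z).2) * r (w z)) ^ 2) ∧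
      (AnalyticAt ℂ ρ (z 2 ^ 4) ∧ ρ (z 2 ^ 4) ^ 4 = -g₁ (z 2 ^ 4))) →
      Θf z 0 ^ 2 + Θf z 1 ^ 2 + Θf z 2 ^ 4 = A (z 1, z 2 ^ 4) * z 0 ^ 2 - G (z 1, z 2 ^ 4) + G (m₀, 0) := by
    rintro z ⟨⟨-, hqz⟩, ⟨-, -, -, -, -, hGz⟩, -, hρz⟩
    rw [hΘf0, hΘf1, hΘf2]
    simp only [hwdef] at hqz hGz ⊢
    have hg := hg₀eq (z 2 ^ 4)
    simp only [hg₀def] at hg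
    have hI : I ^ 2 = -1 := I_sq
    linear_combination (z 0 ^ 2) * hqz + hGz + hg + z 2 ^ 4 * hρz +
      ((z 1 - φ (z 2 ^ 4)) * r (z 1, z 2 ^ 4)) ^ 2 * hI
  -- (6) analyticity at `z₀`, the open set `O`
  have hΘan0 : AnalyticAt ℂ Θf z₀ := han_of_good z₀ hgood.self_of_nhds
  set O : Set (Fin 3 → ℂ) := {z | AnalyticAt ℂ Θf z} with hOdef
  have hO : IsOpen O := isOpen_analyticAt ℂ Θf
  have hz₀O : z₀ ∈ O := hΘan0
  have hΘcd : ContDiffOn ℂ ω Θf O := fun z hz => (show AnalyticAt ℂ Θf z from hz).contDiffAt.contDiffWithinAt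
  -- (7) the derivative at `z₀` is the diagonal `(q p, I·r p, ρ 0)`
  set c : Fin 3 → ℂ := ![q (m₀, 0), I * r (m₀, 0), ρ 0] with hcdef
  have hc0 : ∀ i, c i ≠ 0 := by
    intro i
    fin_cases i <;> simp [hcdef, hq0, hr0, hρ0, I_ne_zero]
  set D : (Fin 3 → ℂ) →L[ℂ] (Fin 3 → ℂ) :=
    ContinuousLinearMap.pi fun i => c i • ContinuousLinearMap.proj (R := ℂ) (φ := fun _ : Fin 3 => ℂ) i with hDdef
  have hD_apply : ∀ v i, D v i = c i * v i := fun v i => by simp [hDdef]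
  have e4 : z₀ 2 ^ 4 = 0 := by simp [hz₀2]
  have hs4d : HasFDerivAt (fun z : Fin 3 → ℂ => z 2 ^ 4)
      ((4 • z₀ 2 ^ (4 - 1)) • ContinuousLinearMap.proj (R := ℂ) (φ := fun _ : Fin 3 => ℂ) 2) z₀ :=
    (hasFDerivAt_apply (𝕜 := ℂ) (2 : Fin 3) z₀).pow 4
  have hwd : HasFDerivAt w (fderiv ℂ w z₀) z₀ := (hw_an z₀).differentiableAt.hasFDerivAt
  have hqd : HasFDerivAt (fun z => q (w z)) ((fderiv ℂ q (m₀, 0)).comp (fderiv ℂ w z₀)) z₀ := by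
    have h : HasFDerivAt q (fderiv ℂ q (m₀, 0)) (w z₀) := by rw [hw0]; exact hq.differentiableAt.hasFDerivAt
    exact h.comp z₀ hwd
  have hrd : HasFDerivAt (fun z => r (w z)) ((fderiv ℂ r (m₀, 0)).comp (fderiv ℂ w z₀)) z₀ := by
    have h : HasFDerivAt r (fderiv ℂ r (m₀, 0)) (w z₀) := by rw [hw0]; exact hr.differentiableAt.hasFDerivAt
    exact h.comp z₀ hwd
  have hφd : HasFDerivAt (fun z : Fin 3 → ℂ => φ (z 2 ^ 4))
      ((fderiv ℂ φ 0).comp ((4 • z₀ 2 ^ (4 - 1)) • ContinuousLinearMap.proj (R := ℂ) (φ := fun _ : Fin 3 => ℂ) 2)) z₀ := by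
    have h : HasFDerivAt φ (fderiv ℂ φ 0) (z₀ 2 ^ 4) := by rw [e4]; exact hφ.differentiableAt.hasFDerivAt
    exact h.comp z₀ hs4d
  have hρd : HasFDerivAt (fun z : Fin 3 → ℂ => ρ (z 2 ^ 4))
      ((fderiv ℂ ρ 0).comp ((4 • z₀ 2 ^ (4 - 1)) • ContinuousLinearMap.proj (R := ℂ) (φ := fun _ : Fin 3 => ℂ) 2)) z₀ := by
    have h : HasFDerivAt ρ (fderiv ℂ ρ 0) (z₀ 2 ^ 4) := by rw [e4]; exact hρ.differentiableAt.hasFDerivAt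
    exact h.comp z₀ hs4d
  have hD : HasFDerivAt Θf D z₀ := by
    apply hasFDerivAt_pi''
    intro i
    fin_cases i
    · -- `Z₀ = y · q(w)`
      show HasFDerivAt (fun z => Θf z 0) _ z₀
      rw [show (fun z => Θf z 0) = fun z => z 0 * q (w z) from funext hΘf0]
      refine ((hasFDerivAt_apply (𝕜 := ℂ) (0 : Fin 3) z₀).mul hqd).congr_fderiv ?_
      ext v
      simp [hD_apply, hcdef, hz₀0, hw0, mul_comm]
    · -- `Z₁ = I · (m − φ(s⁴)) · r(w)`
      show HasFDerivAt (fun z => Θf z 1) _ z₀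
      rw [show (fun z => Θf z 1) = fun z => I * ((z 1 - φ (z 2 ^ 4)) * r (w z)) from funext hΘf1]
      refine ((((hasFDerivAt_apply (𝕜 := ℂ) (1 : Fin 3) z₀).sub hφd).mul hrd).const_mul I).congr_fderiv ?_
      ext v
      simp [hD_apply, hcdef, hz₀1, hz₀2, hw0, hφ0]
      ring
    · -- `Z₂ = s · ρ(s⁴)`
      show HasFDerivAt (fun z => Θf z 2) _ z₀
      rw [show (fun z => Θf z 2) = fun z => z 2 * ρ (z 2 ^ 4) from funext hΘf2]
      refine ((hasFDerivAt_apply (𝕜 := ℂ) (2 : Fin 3) z₀).mul hρd).congr_fderiv ?_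
      ext v
      simp [hD_apply, hcdef, hz₀2, mul_comm]
  -- `D` is invertible
  have hDinj : Function.Injective D := by
    refine (injective_iff_map_eq_zero _).2 fun v hv => ?_
    funext i
    have h := congr_fun hv i
    rw [hD_apply, Pi.zero_apply, mul_eq_zero] at h
    exact h.resolve_left (hc0 i)
  have hDbij : Function.Bijective D :=
    ⟨hDinj, (LinearMap.injective_iff_surjective (f := D.toLinearMap)).1 hDinj⟩
  let Deq : (Fin 3 → ℂ) ≃L[ℂ] (Fin 3 → ℂ) := (LinearEquiv.ofBijective D.toLinearMap hDbij).toContinuousLinearEquiv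
  have hD' : HasFDerivAt Θf (Deq : (Fin 3 → ℂ) →L[ℂ] (Fin 3 → ℂ)) z₀ := by
    convert hD using 1
    ext1 v
    simp [Deq]
  -- (8) the inverse function theorem, packaged with a `C^∞` inverse
  obtain ⟨Φ, hΦf, hz₀Φ, hΦO, hΦcd, hΦsymm, -⟩ :=
    exists_openPartialHomeomorph_contDiffOn_symm hO hz₀O (m := ω) (by exact le_top) hΘcd Deq hD'
  -- (9) a polydisc around `z₀` inside `Φ.source` on which everything holds
  obtain ⟨ε, hε, hball⟩ := Metric.mem_nhds_iff.1 (Filter.inter_mem (Φ.open_source.mem_nhds hz₀Φ) hgood)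
  have hballΦ : ball z₀ ε ⊆ Φ.source := fun z hz => (hball hz).1
  have hballgood := fun z (hz : z ∈ ball z₀ ε) => (hball hz).2
  set Θ := Φ.restrOpen (ball z₀ ε) isOpen_ball with hΘdef
  have hΘsrc : Θ.source = ball z₀ ε := by
    rw [hΘdef, OpenPartialHomeomorph.restrOpen_source, inter_eq_right.2 hballΦ]
  have hΘcoe : (Θ : (Fin 3 → ℂ) → (Fin 3 → ℂ)) = Θf := by
    rw [hΘdef, OpenPartialHomeomorph.coe_restrOpen, hΦf]
  have hΘsymm : ((Θ.symm : _) : (Fin 3 → ℂ) → (Fin 3 → ℂ)) = Φ.symm := by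
    rw [hΘdef, OpenPartialHomeomorph.coe_restrOpen_symm]
  have hΘtgt : Θ.target ⊆ Φ.target := by
    intro x hx
    have h1 : Θ.symm x ∈ Θ.source := Θ.map_target hx
    have h2 : Φ (Φ.symm x) = x := by
      have h := Θ.right_inv hx
      rwa [hΘsymm, hΘdef, OpenPartialHomeomorph.coe_restrOpen] at h
    rw [← h2]
    exact Φ.map_source (hballΦ (by rw [hΘsymm] at h1; rwa [hΘsrc] at h1))
  refine ⟨Θ, ?_, ?_, ?_, ?_, ?_, ?_, ?_⟩
  · rw [hΘsrc]; exact mem_ball_self hε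
  · rw [hΘcoe]
    funext i
    fin_cases i <;> simp [hΘf0, hΘf1, hΘf2, hz₀0, hz₀1, hz₀2, hφ0]
  · rw [hΘcoe, hΘsrc]
    exact fun z hz => (han_of_good z (hballgood z hz)).differentiableAt.differentiableWithinAt
  · rw [hΘsrc]
    exact ((hΦcd.mono hballΦ).restrict_scalars ℝ).of_le le_top |>.congr fun z hz => by rw [hΘcoe, hΦf]
  · rw [hΘsymm]
    exact ((hΦsymm.mono hΘtgt).restrict_scalars ℝ).of_le le_top
  · rw [hΘcoe, hΘsrc]
    exact fun z hz => hNF_of_good z (hballgood z hz)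
  · intro ε₀ ε₂ hε₀ hε₂ z hz
    rw [hΘsrc] at hz ⊢
    have hmem : (fun i => (![ε₀, 1, ε₂] : Fin 3 → ℂ) i * z i) ∈ ball z₀ ε :=
      lt_of_le_of_lt (dist_diag_le m₀ ε₀ ε₂ hε₀ hε₂ z) hz
    refine ⟨hmem, ?_⟩
    rw [hΘcoe]
    have hw' : w (fun i => (![ε₀, 1, ε₂] : Fin 3 → ℂ) i * z i) = w z := by
      simp [hwdef, mul_pow, hε₂]
    funext i
    fin_cases i
    · simp [hΘf0, hw']
      ring
    · simp [hΘf1, hw', mul_pow, hε₂]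
    · simp [hΘf2, mul_pow, hε₂]
      ring

end Literature.Geometry.ComplexAnalytic.EquivariantA3
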